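import Summits.QuantumFields.QCD.Theorems.HeatSlicedQuarksQuarkLoopCoefficientTorusToPlaneAuxD

/-!
# Helper E for stub `stub_torusToPlane` (line `Sketch`, crux `QuarkLoopCoefficient`, item stmt-QuantumFields-16786): periodization of the heat kernel through the exponential series

Continuation of `HeatSlicedQuarksQuarkLoopCoefficientTorusToPlaneAuxD`.  For a Cartan-diagonal
`SU(3)` field `U` on `(ℤ/L)⁴` (`L ≥ 1`) and the pulled-back colour-`a` phases `ũ_a` on `ℤ⁴`:

* `hasSum_exp_neg_smul_apply`: the entrywise exponential series of a complex matrix;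
* `hasSum_heatKer_deck`: **periodization**
  `exp(−t D_Wᴴ D_W)((π x̃, a, α), (π ỹ, a, β)) = Σ_{n ∈ ℤ⁴} (heatKer ũ_a t x̃ (ỹ + L n))_{αβ}`:
  the exponential series on both sides agree term by term (`fibre_sqKerPow`), and the sums over the
  order `m` and the deck label `n` are swapped by absolute convergence (entries of `Hᵐ` are `≤ Rᵐ`,
  `R = 1679616`, and `Hᵐ(x̃, ·)` is supported in a box of `(4m + O(1))⁴ ≤ C · 625ᵐ` deck labels).

Elementary series estimates; Mathlib + the Defs/HeatSeries/TorusToPlaneAuxC–D files.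
-/

noncomputable section

namespace Summit.QuantumFields.QCD.Cruxes.QuarkLoopCoefficient.Sketch.TorusToPlane

open Summit.QuantumFields.QCD.Theorems.QuarkLoopCoefficient
open Literature.MathematicalPhysics.QuantumLattice Literature.MathematicalPhysics.QuantumFieldTheory
open Literature.Probability.LatticeModels (Site TorusSite)
open Summit.QuantumFields.QCD.Cruxes.QuarkLoopCoefficient.Sketch.HeatSeries
open scoped Matrix ComplexConjugate

variable {L : ℕ} (U : GaugeConfig 4 L (Matrix.specialUnitaryGroup (Fin 3) ℂ))

/-! ### §6 Periodization of the heat kernel through the exponential series -/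

/-- Entrywise exponential series of a matrix: `exp(−tA)_{ij} = Σ_m (−t)ᵐ/m! · (Aᵐ)_{ij}`. -/
theorem hasSum_exp_neg_smul_apply {ι : Type*} [Fintype ι] [DecidableEq ι] (A : Matrix ι ι ℂ) (t : ℝ) (i j : ι) :
    HasSum (fun m : ℕ => ((((-t) ^ m / (m.factorial : ℝ) : ℝ)) : ℂ) * (A ^ m) i j)
      (NormedSpace.exp (-(t : ℂ) • A) i j) := by
  open scoped Matrix.Norms.Operator in
  have h := NormedSpace.exp_series_hasSum_exp' (𝕂 := ℂ) (-(t : ℂ) • A)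
  have h2 := Pi.hasSum.mp (Pi.hasSum.mp h i) j
  refine h2.congr_fun fun m => ?_
  rw [smul_pow, Matrix.smul_apply, Matrix.smul_apply, smul_eq_mul, smul_eq_mul, coeff_eq]
  ring

/-- **Periodization of the heat kernel of a Cartan-diagonal field.** For `L ≥ 1`, every `t`, colour
`a`, spins `α, β` and lifts `x̃, ỹ`: the torus heat kernel entry is the deck sum of the `ℤ⁴` heat kernel
of the pulled-back colour-`a` phases,
`exp(−t D_Wᴴ D_W)((π x̃, a, α), (π ỹ, a, β)) = Σ_{n ∈ ℤ⁴} (heatKer ũ_a t x̃ (ỹ + L n))_{αβ}`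
(exponential series on both sides, `fibre_sqKerPow` termwise, and an absolutely convergent swap of the
sums over `m` and `n`: `Hᵐ(x̃, ·)` has entries `≤ Rᵐ` and support in a box of `O(m⁴)` deck labels). -/
theorem hasSum_heatKer_deck [NeZero L]
    (hdiag : ∀ (e : Edge 4 L) (i j : Fin 3), i ≠ j → (fundamentalRep (Fin 3)) (U e) i j = 0)
    (t : ℝ) (xt : Site 4) (a : Fin 3) (α : Fin 4) (yt : Site 4) (β : Fin 4) :
    HasSum (fun n : Site 4 =>
        heatKer (fun e => (fundamentalRep (Fin 3)) (U ((fun ν => ((e.1 ν : ℤ) : ZMod L)), e.2)) a a) t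
          xt (yt + fun μ => (L : ℤ) * n μ) α β)
      (torusHeat U t ((fun ν => ((xt ν : ℤ) : ZMod L)), a, α) ((fun ν => ((yt ν : ℤ) : ZMod L)), a, β)) := by
  -- the pulled-back phases are bounded by one (entries of unitary matrices)
  have hu : ∀ e : ZdEdge 4,
      ‖(fundamentalRep (Fin 3)) (U ((fun ν => ((e.1 ν : ℤ) : ZMod L)), e.2)) a a‖ ≤ 1 :=
    fun e => entry_norm_bound_of_unitary (fundamentalRep_mem_unitaryGroup _) a a
  -- the double family `F (m, n) = (−t)ᵐ/m! · Hᵐ(x̃, ỹ + L n)_{αβ}`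
  set F : ℕ × Site 4 → ℂ := fun p => ((((-t) ^ p.1 / (p.1.factorial : ℝ) : ℝ)) : ℂ) *
    sqKerPow (fun e => (fundamentalRep (Fin 3)) (U ((fun ν => ((e.1 ν : ℤ) : ZMod L)), e.2)) a a)
      p.1 xt (yt + fun μ => (L : ℤ) * p.2 μ) α β with hF
  -- (1) absolute summability of `F`
  set d : ℤ := ∑ ν, |xt ν - yt ν| with hd
  have hd0 : 0 ≤ d := Finset.sum_nonneg fun ν _ => abs_nonneg _
  have hterm : ∀ (m : ℕ) (n : Site 4), ‖F (m, n)‖ ≤ |t| ^ m / (m.factorial : ℝ) * (1679616 : ℝ) ^ m := by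
    intro m n
    rw [hF, norm_mul, norm_coeff]
    exact mul_le_mul_of_nonneg_left (norm_sqKerPow_le hu m xt _ α β) (by positivity)
  have hzero : ∀ (m : ℕ) (n : Site 4), n ∉ (Fintype.piFinset fun _ : Fin 4 =>
      Finset.Icc (-(2 * (m : ℤ) + d)) (2 * (m : ℤ) + d)) → F (m, n) = 0 := by
    intro m n hn
    rw [hF]
    simp only
    rw [sqKerPow_deck_eq_zero _ m xt yt n hn, Matrix.zero_apply, mul_zero]
  have hrow : ∀ m : ℕ, ∑' n : Site 4, ‖F (m, n)‖ ≤
      ((2 * d + 1 : ℤ) : ℝ) ^ 4 * ((625 * 1679616 * |t|) ^ m / (m.factorial : ℝ)) := by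
    intro m
    rw [tsum_eq_sum (s := Fintype.piFinset fun _ : Fin 4 =>
      Finset.Icc (-(2 * (m : ℤ) + d)) (2 * (m : ℤ) + d)) (fun n hn => by rw [hzero m n hn, norm_zero])]
    refine (Finset.sum_le_sum fun n _ => hterm m n).trans ?_
    rw [Finset.sum_const, nsmul_eq_mul, card_deckBox _ (by positivity)]
    have hbox : ((2 * (2 * (m : ℤ) + d) + 1 : ℤ) : ℝ) ^ 4 ≤ ((2 * d + 1 : ℤ) : ℝ) ^ 4 * (625 : ℝ) ^ m := by
      have h1 : ((2 * (2 * (m : ℤ) + d) + 1 : ℤ) : ℝ) ≤ ((2 * d + 1 : ℤ) : ℝ) * (4 * (m : ℝ) + 1) := by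
        push_cast
        have : (0 : ℝ) ≤ (d : ℝ) := by exact_mod_cast hd0
        nlinarith
      have h2 : ((2 * d + 1 : ℤ) : ℝ) * (4 * (m : ℝ) + 1) ≤ ((2 * d + 1 : ℤ) : ℝ) * 5 ^ m :=
        mul_le_mul_of_nonneg_left (four_mul_add_one_le_pow m) (by push_cast; positivity)
      calc ((2 * (2 * (m : ℤ) + d) + 1 : ℤ) : ℝ) ^ 4 ≤ (((2 * d + 1 : ℤ) : ℝ) * 5 ^ m) ^ 4 :=
            pow_le_pow_left₀ (by push_cast; positivity) (h1.trans h2) 4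
        _ = ((2 * d + 1 : ℤ) : ℝ) ^ 4 * (625 : ℝ) ^ m := by
            rw [mul_pow, ← pow_mul, show (5 : ℝ) ^ (m * 4) = 625 ^ m by
              rw [mul_comm, pow_mul]; norm_num]
    have hcast : ((2 * (2 * (m : ℤ) + d) + 1 : ℤ) : ℝ) = 2 * ((2 * (m : ℤ) + d : ℤ) : ℝ) + 1 := by push_cast; ring
    rw [← hcast]
    calc ((2 * (2 * (m : ℤ) + d) + 1 : ℤ) : ℝ) ^ 4 * (|t| ^ m / (m.factorial : ℝ) * 1679616 ^ m)
        ≤ ((2 * d + 1 : ℤ) : ℝ) ^ 4 * (625 : ℝ) ^ m * (|t| ^ m / (m.factorial : ℝ) * 1679616 ^ m) :=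
          mul_le_mul_of_nonneg_right hbox (by positivity)
      _ = ((2 * d + 1 : ℤ) : ℝ) ^ 4 * ((625 * 1679616 * |t|) ^ m / (m.factorial : ℝ)) := by
          rw [mul_pow, mul_pow]; ring
  have hFsum : Summable F := by
    refine Summable.of_norm ?_
    refine (summable_prod_of_nonneg fun p => norm_nonneg _).mpr ⟨fun m => ?_, ?_⟩
    · exact summable_of_ne_finset_zero (s := Fintype.piFinset fun _ : Fin 4 =>
        Finset.Icc (-(2 * (m : ℤ) + d)) (2 * (m : ℤ) + d)) fun n hn => by
          show ‖F (m, n)‖ = 0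
          rw [hzero m n hn, norm_zero]
    · refine Summable.of_nonneg_of_le (fun m => tsum_nonneg fun n => norm_nonneg _) hrow ?_
      exact ((Real.summable_pow_div_factorial (625 * 1679616 * |t|)).mul_left _)
  obtain ⟨S, hS⟩ := hFsum
  -- (2) fibres over the deck label: the `ℤ⁴` heat kernel entries
  have hfib_n : ∀ n : Site 4, HasSum (fun m : ℕ => F (m, n))
      (heatKer (fun e => (fundamentalRep (Fin 3)) (U ((fun ν => ((e.1 ν : ℤ) : ZMod L)), e.2)) a a) t
        xt (yt + fun μ => (L : ℤ) * n μ) α β) :=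
    fun n => hasSum_heatKer_apply
      (u := fun e => (fundamentalRep (Fin 3)) (U ((fun ν => ((e.1 ν : ℤ) : ZMod L)), e.2)) a a)
      hu t xt (yt + fun μ => (L : ℤ) * n μ) α β
  -- (3) fibres over the order: the torus kernel powers
  have hfib_m : ∀ m : ℕ, HasSum (fun n : Site 4 => F (m, n))
      (((((-t) ^ m / (m.factorial : ℝ) : ℝ)) : ℂ) *
        ((((wilsonDirac (fundamentalRep (Fin 3)) U 0 1)ᴴ * wilsonDirac (fundamentalRep (Fin 3)) U 0 1) ^ m)
          ((fun ν => ((xt ν : ℤ) : ZMod L)), a, α) ((fun ν => ((yt ν : ℤ) : ZMod L)), a, β))) := by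
    intro m
    have h := (fibre_sqKerPow U hdiag m xt a α yt a β).mul_left ((((-t) ^ m / (m.factorial : ℝ) : ℝ)) : ℂ)
    simp only [if_true] at h
    exact h
  -- (4) assemble: both iterated sums equal the unconditional double sum `S`
  have h1 : HasSum (fun n : Site 4 =>
      heatKer (fun e => (fundamentalRep (Fin 3)) (U ((fun ν => ((e.1 ν : ℤ) : ZMod L)), e.2)) a a) t
        xt (yt + fun μ => (L : ℤ) * n μ) α β) S :=
    ((Equiv.hasSum_iff (Equiv.prodComm (Site 4) ℕ)).mpr hS).prod_fiberwise hfib_n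
  have h2 := hS.prod_fiberwise hfib_m
  have h3 := hasSum_exp_neg_smul_apply
    ((wilsonDirac (fundamentalRep (Fin 3)) U 0 1)ᴴ * wilsonDirac (fundamentalRep (Fin 3)) U 0 1) t
    ((fun ν => ((xt ν : ℤ) : ZMod L)), a, α) ((fun ν => ((yt ν : ℤ) : ZMod L)), a, β)
  unfold torusHeat
  rw [h3.unique h2]
  exact h1
/-! ### Registered headline -/

/-- Registered headline of this helper file (aux stub `stub_torusToPlaneAuxE` of crux
stmt-QuantumFields-16786, line `Sketch`): periodization of the torus heat kernel of a Cartan-diagonal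
field as a deck sum of the `ℤ⁴` heat kernel of the pulled-back colour phases. -/
theorem stub_torusToPlaneAuxE :
    ∀ (L : ℕ) [NeZero L] (U : GaugeConfig 4 L (Matrix.specialUnitaryGroup (Fin 3) ℂ)),
      (∀ (e : Edge 4 L) (i j : Fin 3), i ≠ j → (fundamentalRep (Fin 3)) (U e) i j = 0) →
      ∀ (t : ℝ) (xt : Site 4) (a : Fin 3) (α : Fin 4) (yt : Site 4) (β : Fin 4),
        HasSum (fun n : Site 4 =>
            heatKer (fun e => (fundamentalRep (Fin 3)) (U ((fun ν => ((e.1 ν : ℤ) : ZMod L)), e.2)) a a) t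
              xt (yt + fun μ => (L : ℤ) * n μ) α β)
          (torusHeat U t ((fun ν => ((xt ν : ℤ) : ZMod L)), a, α) ((fun ν => ((yt ν : ℤ) : ZMod L)), a, β)) :=
  fun _ _ U hdiag => hasSum_heatKer_deck U hdiag

end Summit.QuantumFields.QCD.Cruxes.QuarkLoopCoefficient.Sketch.TorusToPlane

end
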